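import Summits.QuantumAdvantage.AdviceFreeQNC0.WalkGapNaming
import HarnessLib

/-!
# Cell qa-qnc0 (odd primes `p ≥ 5`, towards rung R6 `√n`-shots): the fibre game reads only SIX CLASS PARITIES

Planner qa-qnc0-p2 g14, ROUND-14 §3 Observation A ("R factors through six parities"): in the fibre over a cut-free interval
(`WalkGapFibre.lean` / `WalkGapNaming.lean`) the win bit `GapFibre.F i L c A u Y t` is the parity of the number of active cuts `g`
with `κ_g(u) + speed_g·t ≢ 0 (mod 3)`; grouping the cuts by their CLASS `(κ_g mod 3, speed_g) ∈ ℤ/3 × {1,2}`, the condition is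
constant on each class, so `F` — and hence the named losing residue `GapFibre.R` — depends on the activity pattern `Y` only through
the six class parities `classParity … Y a η = #{g ∈ A active : κ_g ≡ a, speed_g = η} mod 2`.  PROVED here:

* `GapFibre.card_filter_eq_sum_classes` — the class decomposition of the fibre count;
* **`GapFibre.F_eq_of_classParity`**, **`GapFibre.R_eq_of_classParity`** — equal class parities ⇒ equal win bits / named residue;
* `GapFibre.namedRes_eq_of_classParity` — the fibre's naming function `z ↦ namedRes (ow u z)` factors through the six parities
  of the fired classes.

This is the input that lets the `√n`-shots rung replace the exact pattern degree `B·D` (`WalkGapShots.lean`) by the PROBABILISTIC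
degree of six promise parities (qn-lit g16's `ufam_promiseParity_comp` / `UFam.boolPost`, STV21 Cor. 19) — assembly to follow.
WHAT THIS IS NOT: no hardness statement; separation NOT moved.
-/

noncomputable section

namespace Summit.QuantumAdvantage.AdviceFreeQNC0

open Classical
open Finset

variable {n : ℕ}

namespace GapFibre

/-- The CLASS PARITY of an activity pattern: the parity of the number of active cuts of `A` with fibre constant
`κ ≡ a (mod 3)` and speed `η`. -/
def classParity (i L c : ℕ) (A : Finset (Fin (n + 1))) (u : Fin n → Bool) (Y : Fin (n + 1) → Bool) (a η : ℕ) : Bool :=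
  decide ((A.filter fun g : Fin (n + 1) =>
    Y g = true ∧ kappa i L c u g.val % 3 = a ∧ speed i g.val = η).card % 2 = 1)

/-- The six classes `(a, η) ∈ {0,1,2} × {1,2}`. -/
def classes : Finset (ℕ × ℕ) := (Finset.range 3) ×ˢ ({1, 2} : Finset ℕ)

/-- Every cut lies in exactly one class. -/
theorem class_mem (i L c : ℕ) (u : Fin n → Bool) (g : ℕ) :
    (kappa i L c u g % 3, speed i g) ∈ classes := by
  unfold classes speed
  rw [Finset.mem_product, Finset.mem_range]
  refine ⟨Nat.mod_lt _ (by norm_num), ?_⟩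
  split_ifs <;> simp

/-- **Class decomposition of the fibre count**: the number of active cuts passing the test at hidden residue `t` is the sum,
over the classes `(a, η)` with `a + η·t ≢ 0 (mod 3)`, of the class sizes. -/
theorem card_filter_eq_sum_classes (i L c : ℕ) (A : Finset (Fin (n + 1))) (u : Fin n → Bool)
    (Y : Fin (n + 1) → Bool) (t : ℕ) :
    (A.filter fun g : Fin (n + 1) => Y g = true ∧ (kappa i L c u g.val + speed i g.val * t) % 3 ≠ 0).card =
      ∑ q ∈ classes.filter (fun q : ℕ × ℕ => (q.1 + q.2 * t) % 3 ≠ 0),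
        (A.filter fun g : Fin (n + 1) => Y g = true ∧ kappa i L c u g.val % 3 = q.1 ∧ speed i g.val = q.2).card := by
  rw [Finset.card_eq_sum_card_fiberwise (f := fun g : Fin (n + 1) => (kappa i L c u g.val % 3, speed i g.val))
    (t := classes.filter (fun q : ℕ × ℕ => (q.1 + q.2 * t) % 3 ≠ 0)) (fun g hg => by
      have hg' := Finset.mem_coe.1 hg
      rw [mem_filter] at hg'
      refine Finset.mem_coe.2 (Finset.mem_filter.2 ⟨class_mem i L c u g.val, ?_⟩)
      have h : (kappa i L c u g.val + speed i g.val * t) % 3 =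
          (kappa i L c u g.val % 3 + speed i g.val * t) % 3 := by omega
      show (kappa i L c u g.val % 3 + speed i g.val * t) % 3 ≠ 0
      rw [← h]; exact hg'.2.2)]
  refine Finset.sum_congr rfl fun q hq => ?_
  rw [mem_filter] at hq
  congr 1
  ext g
  simp only [mem_filter, Prod.ext_iff]
  constructor
  · rintro ⟨⟨hgA, hY, _⟩, h1, h2⟩
    exact ⟨hgA, hY, h1, h2⟩
  · rintro ⟨hgA, hY, h1, h2⟩
    refine ⟨⟨hgA, hY, ?_⟩, h1, h2⟩
    have h : (kappa i L c u g.val + speed i g.val * t) % 3 = (q.1 + q.2 * t) % 3 := by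
      rw [← h1, ← h2]; omega
    rw [h]; exact hq.2

/-- **Equal class parities ⇒ equal win bits** (the fibre game reads `Y` only through the six class parities). -/
theorem F_eq_of_classParity (i L c : ℕ) (A : Finset (Fin (n + 1))) (u : Fin n → Bool) {Y Y' : Fin (n + 1) → Bool}
    (h : ∀ a η : ℕ, classParity i L c A u Y a η = classParity i L c A u Y' a η) (t : ℕ) :
    F i L c A u Y t = F i L c A u Y' t := by
  unfold F
  rw [card_filter_eq_sum_classes, card_filter_eq_sum_classes]
  have hmod : ∀ q : ℕ × ℕ,
      (A.filter fun g : Fin (n + 1) => Y g = true ∧ kappa i L c u g.val % 3 = q.1 ∧ speed i g.val = q.2).card % 2 =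
      (A.filter fun g : Fin (n + 1) => Y' g = true ∧ kappa i L c u g.val % 3 = q.1 ∧ speed i g.val = q.2).card % 2 := by
    intro q
    have hq := h q.1 q.2
    unfold classParity at hq
    have h1 := Nat.mod_two_eq_zero_or_one
      (A.filter fun g : Fin (n + 1) => Y g = true ∧ kappa i L c u g.val % 3 = q.1 ∧ speed i g.val = q.2).card
    have h2 := Nat.mod_two_eq_zero_or_one
      (A.filter fun g : Fin (n + 1) => Y' g = true ∧ kappa i L c u g.val % 3 = q.1 ∧ speed i g.val = q.2).card
    rcases h1 with h1 | h1 <;> rcases h2 with h2 | h2 <;> simp [h1, h2] at hq ⊢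
  congr 1
  rw [Finset.sum_nat_mod, Finset.sum_congr rfl (fun q _ => hmod q), ← Finset.sum_nat_mod]

/-- **Equal class parities ⇒ equal named residue.** -/
theorem R_eq_of_classParity (i L c : ℕ) (A : Finset (Fin (n + 1))) (u : Fin n → Bool) {Y Y' : Fin (n + 1) → Bool}
    (h : ∀ a η : ℕ, classParity i L c A u Y a η = classParity i L c A u Y' a η) :
    R i L c A u Y = R i L c A u Y' := by
  unfold R
  rw [F_eq_of_classParity i L c A u h 0, F_eq_of_classParity i L c A u h 1]

/-- **The fibre's naming function factors through the six parities of the fired classes**: if at `z` and `z'` the fired cuts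
of `ow u z` and `ow u z'` have the same six class parities, the named residues agree. -/
theorem namedRes_eq_of_classParity (i L c : ℕ) (y : Fin (n + 1) → (Fin n → Bool) → Bool) (u : Fin n → Bool)
    {z z' : Fin L → Bool}
    (h : ∀ a η : ℕ, classParity i L c (activeCuts y) u (fun g => y g (ow i L u z)) a η =
      classParity i L c (activeCuts y) u (fun g => y g (ow i L u z')) a η) :
    namedRes i L c y u z = namedRes i L c y u z' := by
  unfold namedRes
  exact R_eq_of_classParity i L c (activeCuts y) u h

end GapFibre

end Summit.QuantumAdvantage.AdviceFreeQNC0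

end
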